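import Summits.QuantumFields.YangMills.Theorems.F4SubCurvatureDoorLaplaceFourierRegistered
import Mathlib
import HarnessLib

/-!
# S1 «APERTURE BOOTSTRAP» — the GLOBAL-DISC mechanism, typed (v6 block of `Lines/forward_cone_rungs.lean`; registry unchanged; no stubs)

See `Lines/forward_cone_discs.md` for the numerical disc certificates (kit jobs j331932/j332216/j332231) and the envelope analysis.
Nothing here is an obligation of a line; no summit, rung or crux is proved by this file.
-/

set_option autoImplicit false

noncomputable section

namespace Summit.QuantumFields.YangMills.Cruxes.RationalToGeneral.ForwardConeDiscs

open scoped BigOperators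
open MeasureTheory
open Summit.QuantumFields.YangMills.Theorems.F4SubCurvatureDoorLaplaceFourierRegistered (E4 E3 InClass timeSpace IsLF)

/-- A vector of `E4` from four coordinates. -/
def mk4 (a b c d : ℝ) : E4 := (WithLp.equiv 2 (Fin 4 → ℝ)).symm ![a, b, c, d]

/-- The 15 FORWARD frames `u` (`u₀ ≥ 0`): `e₀`, the eight half-integer short roots `(1, ±1, ±1, ±1)/2`, and `±e_j` (`j = 1,2,3`).
The union of their tubes is invariant under positive real time shifts, which is what the disc-family argument uses. -/
def forwardFrames : List E4 :=
  [mk4 1 0 0 0,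
   mk4 (1/2) (1/2) (1/2) (1/2), mk4 (1/2) (1/2) (1/2) (-1/2), mk4 (1/2) (1/2) (-1/2) (1/2), mk4 (1/2) (1/2) (-1/2) (-1/2),
   mk4 (1/2) (-1/2) (1/2) (1/2), mk4 (1/2) (-1/2) (1/2) (-1/2), mk4 (1/2) (-1/2) (-1/2) (1/2), mk4 (1/2) (-1/2) (-1/2) (-1/2),
   mk4 0 1 0 0, mk4 0 (-1) 0 0, mk4 0 0 1 0, mk4 0 0 (-1) 0, mk4 0 0 0 1, mk4 0 0 0 (-1)]

/-- MARGIN of the point `x + iy ∈ ℂ⁴` in the frame tube `T_u(κ) = {κ x·u > |y − (y·u)u|}` (the convergence tube of a frame-`u` Laplace–Fourier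
integral whose measure has aperture `κ`; the component of `y` along `u` is a phase and is free). -/
def frameMargin (κ : ℝ) (u x y : E4) : ℝ := κ * inner ℝ x u - ‖y - (inner ℝ y u) • u‖

/-- Real part of the boundary point `P⋆ + Σ_{j<d} c_j e^{i(j+1)θ}` of a polynomial disc, `c_j = a_j + i b_j`, `P⋆ = (1,0⃗) + i(0, κ n⃗)`. -/
def discRe {d : ℕ} (a b : Fin d → E4) (θ : ℝ) : E4 :=
  mk4 1 0 0 0 + ∑ j : Fin d, (Real.cos (((j.val + 1 : ℕ) : ℝ) * θ) • a j - Real.sin (((j.val + 1 : ℕ) : ℝ) * θ) • b j)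

/-- Imaginary part of the same boundary point. -/
def discIm {d : ℕ} (κ : ℝ) (n : E3) (a b : Fin d → E4) (θ : ℝ) : E4 :=
  timeSpace 0 (κ • n) + ∑ j : Fin d, (Real.sin (((j.val + 1 : ℕ) : ℝ) * θ) • a j + Real.cos (((j.val + 1 : ℕ) : ℝ) * θ) • b j)

/-- «DISC THROUGH THE EDGE» in direction `n⃗` at aperture `κ`: a polynomial analytic disc centred at the time-axis Landau point
`P⋆(n⃗) = (1, 0⃗) + i(0, κn⃗) ∈ ∂T₀(κ)` whose whole boundary circle lies in the union of the 15 forward tubes with a positive margin.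
NUMERICAL CERTIFICATES (kit j331932, verified on 2·10⁵ boundary points): `κ = 1/2`, `n⃗ = (1,1,1)/√3` margin 0.0958 (the A₂ mechanism) and
`n⃗ = (0.36, 0.48, 0.8)` (18.7° off the diagonal, in NO hexagonal plane) margin 0.0517, both with `d = 2` and frames `e₀, (1,±(1,1,1))/2`. -/
def DiscThroughEdge (κ : ℝ) (n : E3) : Prop :=
  ∃ (d : ℕ) (a b : Fin d → E4) (m : ℝ), 0 < m ∧
    ∀ θ : ℝ, ∃ u ∈ forwardFrames, m ≤ frameMargin κ u (discRe a b θ) (discIm κ n a b θ)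

/-- «DIRECTIONAL GAIN»: for every class kernel whose Laplace–Fourier measure has aperture `κ`, the measure gives no mass to the acausal
half-space region `{E < κ' n⃗·q⃗}` (stated for any `n⃗ ≠ 0`, normalised by `‖n⃗‖`). -/
def DirectionalGain (κ κ' : ℝ) (n : E3) : Prop :=
  ∀ (K : E4 → ℝ) (μ : Measure (ℝ × E3)), InClass K → IsLF K μ →
    μ {p | p.1 < κ * ‖p.2‖} = 0 → μ {p | p.1 * ‖n‖ < κ' * inner ℝ n p.2} = 0

/-- R-S1◐ «DISC GAIN» (M–L; the 4-D version of ✓`flatDoubleEdgeModel_holds` + STUB-PLAN R-S3d H4–H10): a disc through the edge in direction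
`n⃗` at aperture `κ` yields a directional gain `κ' > κ` at `n⃗`.  MECHANISM: the frame functions glue to one holomorphic `F` on the union `X⁺` of
the 15 forward tubes (pairwise identity theorem from the real points); `X⁺ + σe₀ ⊆ X⁺` for `σ ≥ 0`, so `G(q) := ∮ F(q + A(λ)) dλ/2πiλ` over the
translated disc is holomorphic for `q` near `P⋆ + [0,∞)e₀` and equals `F₀(q)` once `q + A(𝔻̄) ⊂ T₀` (mean value) — hence near `P⋆` (identity
theorem along the ray); conic scaling `t·(disc)` has margins `m·t`, so the frame majorants give a bound UNIFORM in `t ≥ 1`; in the complex line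
`{(t, β n⃗)}` the strip `|Im β| < κt` plus the two discs at `±iκt` contain the disc `|β| < (κ + δ″)t`; Lukacs on that disc
(`Literature.Analysis.Complex.integral_exp_le_of_laplaceFourier_eq_on_ball`) bounds `∫ e^{−tE} e^{±(κ+δ″/2)t n⃗·q⃗} dμ` uniformly in `t`; pinning
`t → ∞` gives the gain.  WHY IT MIGHT FAIL: only through a typing slip — every step is a landed pattern (✓p722711, ✓p723152, ✓p717267). -/
def DiscGain : Prop :=
  ∀ (κ : ℝ) (n : E3), 0 < κ → κ < 1 → ‖n‖ = 1 → DiscThroughEdge κ n → ∃ κ' : ℝ, κ < κ' ∧ DirectionalGain κ κ' n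

/-- «DISCS EVERYWHERE» (OPEN — numerically DOUBTFUL for the round tubes: kit j331932 finds margin ≈ 0⁻ at the axis and mid directions for
degree ≤ 4; j332231 decides it with a convex alternation): at every aperture `κ < 1` and every direction there is a disc through the edge.  With
`DiscGain` and `apertureBootstrap_of_uniformGain` below (plus a compactness step making `κ'` uniform in `n⃗`, automatic if the disc data vary
continuously) this would prove `ApertureBootstrap`.  If it is false for round tubes, the correct object is the CONVEX-BODY bootstrap of
`Lines/forward_cone_discs.md` §4 (tubes over the current aperture body, bulged where gains occurred). -/
def DiscsEverywhere : Prop :=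
  ∀ (κ : ℝ) (n : E3), 0 < κ → κ < 1 → ‖n‖ = 1 → DiscThroughEdge κ n

/-- «UNIFORM DIRECTIONAL GAIN»: at every aperture `κ < 1` one `κ' > κ` works for all directions. -/
def UniformDirectionalGain : Prop :=
  ∀ κ : ℝ, 0 < κ → κ < 1 → ∃ κ' : ℝ, κ < κ' ∧ ∀ n : E3, n ≠ 0 → DirectionalGain κ κ' n

/-- `ApertureBootstrap` verbatim from `Lines/forward_cone_rungs.lean`. -/
def ApertureBootstrap : Prop :=
  ∀ κ : ℝ, 0 < κ → κ < 1 → ∃ κ' : ℝ, κ < κ' ∧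
    ∀ (K : E4 → ℝ) (μ : Measure (ℝ × E3)), InClass K → IsLF K μ →
      μ {p | p.1 < κ * ‖p.2‖} = 0 → μ {p | p.1 < κ' * ‖p.2‖} = 0

/-! ## Proved reduction: uniform directional gains ⇒ `ApertureBootstrap` (countable dense net of directions) -/

theorem apertureBootstrap_of_uniformGain (h : UniformDirectionalGain) : ApertureBootstrap := by
  intro κ hκ hκ1
  obtain ⟨κ', hκκ', hgain⟩ := h κ hκ hκ1
  refine ⟨(κ + κ') / 2, by linarith, ?_⟩
  intro K μ hK hμ hap
  set κ'' : ℝ := (κ + κ') / 2 with hκ''def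
  have hκ'pos : 0 < κ' := lt_trans hκ hκκ'
  have hκ''pos : 0 < κ'' := by rw [hκ''def]; linarith
  have hκ''lt : κ'' < κ' := by rw [hκ''def]; linarith
  obtain ⟨D, hDc, hDd⟩ := TopologicalSpace.exists_countable_dense E3
  -- ε with κ''(1+ε) ≤ κ'(1-ε)
  set ε : ℝ := (κ' - κ'') / (κ' + κ'') with hεdef
  have hεpos : 0 < ε := by rw [hεdef]; exact div_pos (by linarith) (by linarith)
  have hεlt : ε < 1 := by
    rw [hεdef, div_lt_one (by linarith)]; linarith
  have hεkey : κ'' * (1 + ε) ≤ κ' * (1 - ε) := by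
    rw [hεdef]
    have hs : 0 < κ' + κ'' := by linarith
    rw [show κ'' * (1 + (κ' - κ'') / (κ' + κ'')) = κ'' * (2 * κ') / (κ' + κ'') by field_simp; ring,
        show κ' * (1 - (κ' - κ'') / (κ' + κ'')) = κ' * (2 * κ'') / (κ' + κ'') by field_simp; ring]
    apply le_of_eq; ring
  have hcover : {p : ℝ × E3 | p.1 < κ'' * ‖p.2‖} ⊆
      (Set.Iio (0:ℝ) ×ˢ (Set.univ : Set E3)) ∪ ⋃ n ∈ D, {p : ℝ × E3 | p.1 * ‖n‖ < κ' * inner ℝ n p.2} := by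
    intro p hp
    simp only [Set.mem_setOf_eq] at hp
    by_cases hneg : p.1 < 0
    · exact Or.inl ⟨hneg, Set.mem_univ _⟩
    · right
      push Not at hneg
      have hr : 0 < ‖p.2‖ := by
        rcases (norm_nonneg p.2).lt_or_eq with h1 | h1
        · exact h1
        · exfalso; rw [← h1, mul_zero] at hp; linarith
      set r := ‖p.2‖ with hrdef
      obtain ⟨n, hnball, hnD⟩ := Metric.dense_iff.mp hDd p.2 (ε * r) (by positivity)
      have hdist : ‖n - p.2‖ < ε * r := by
        rw [Metric.mem_ball, dist_eq_norm] at hnball; exact hnball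
      refine Set.mem_iUnion₂.mpr ⟨n, hnD, ?_⟩
      simp only [Set.mem_setOf_eq]
      have hn_le : ‖n‖ ≤ (1 + ε) * r := by
        have h1 : ‖n‖ ≤ ‖n - p.2‖ + ‖p.2‖ := by
          have := norm_add_le (n - p.2) p.2; simpa using this
        rw [← hrdef] at h1; nlinarith [h1, hdist.le]
      have hinner : (1 - ε) * r ^ 2 ≤ inner ℝ n p.2 := by
        have hsplit : inner ℝ n p.2 = inner ℝ p.2 p.2 + inner ℝ (n - p.2) p.2 := by
          rw [inner_sub_left]; ring
        have hself : inner ℝ p.2 p.2 = r ^ 2 := by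
          rw [hrdef]; exact real_inner_self_eq_norm_sq p.2
        have hcs : |inner ℝ (n - p.2) p.2| ≤ ‖n - p.2‖ * ‖p.2‖ := abs_real_inner_le_norm _ _
        have h2 : ‖n - p.2‖ * ‖p.2‖ ≤ ε * r * r := by
          rw [← hrdef]; exact mul_le_mul_of_nonneg_right hdist.le hr.le
        have h1 := neg_abs_le (inner ℝ (n - p.2) p.2)
        rw [hsplit, hself]; nlinarith
      have hn_pos : 0 < ‖n‖ := by
        have h1 : ‖p.2‖ ≤ ‖n‖ + ‖n - p.2‖ := by
          have := norm_sub_le n (n - p.2); simpa using this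
        rw [← hrdef] at h1; nlinarith [hdist, hεlt, hr]
      calc p.1 * ‖n‖ < κ'' * r * ‖n‖ := by
            exact mul_lt_mul_of_pos_right hp hn_pos
        _ ≤ κ'' * r * ((1 + ε) * r) := by
            exact mul_le_mul_of_nonneg_left hn_le (by positivity)
        _ = κ'' * (1 + ε) * r ^ 2 := by ring
        _ ≤ κ' * (1 - ε) * r ^ 2 := by
            exact mul_le_mul_of_nonneg_right hεkey (by positivity)
        _ ≤ κ' * inner ℝ n p.2 := by
            have := mul_le_mul_of_nonneg_left hinner hκ'pos.le
            linarith
  have hnull : μ ((Set.Iio (0:ℝ) ×ˢ (Set.univ : Set E3)) ∪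
      ⋃ n ∈ D, {p : ℝ × E3 | p.1 * ‖n‖ < κ' * inner ℝ n p.2}) = 0 := by
    apply measure_union_null hμ.1
    rw [measure_biUnion_null_iff hDc]
    intro n hnD
    by_cases hn0 : n = 0
    · subst hn0
      have : {p : ℝ × E3 | p.1 * ‖(0:E3)‖ < κ' * inner ℝ (0:E3) p.2} = ∅ := by
        ext p; simp
      rw [this]; exact measure_empty
    · exact hgain n hn0 K μ hK hμ hap
  exact measure_mono_null hcover hnull

end Summit.QuantumFields.YangMills.Cruxes.RationalToGeneral.ForwardConeDiscs

end
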